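import Literature.AlgebraicGeometry.Resolution.RelativeDimensionCurve
import Literature.AlgebraicGeometry.Motives.AbelianVarietyIsogenyProofs
import Literature.Topology.KrullDimensionDrop
import Mathlib.AlgebraicGeometry.Morphisms.UniversallyOpen
import Mathlib.AlgebraicGeometry.Morphisms.Integral
import Mathlib.AlgebraicGeometry.Noetherian
import HarnessLib

/-!
# Irreducible components and their dimensions under flat integral morphisms

Topic: `Literature/AlgebraicGeometry/Resolution`. Generic topology and scheme theory serving the
strict transform of de Jong 1996, 4.15 (`AlterationsSectionsReduction.lean`: the fibres of
`f' : (Y' ×_Y X)_red → Y'` are the fibres of `f` base-changed along the residue field extensions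
`κ(ψ y') ⊂ κ(y')`, and "(vi) a) all fibres are […] equidimensional of dimension 1. (vi) b) The
smooth locus of `f` is dense in all fibres" must survive). For a morphism `π : F' → F` which is
FLAT (generizations lift, Mathlib `Flat.generalizingMap`) and INTEGRAL (closed, with incomparable
fibres) — e.g. the base change of a scheme over a field `κ` to an algebraic extension of `κ` —
everything here is PROVED:

* topology: the generic points of the irreducible components of a sober `T₀` space are the
  points maximal for specialisation (`mem_genericPoints_iff_forall_specializes`); a generalizing
  map sends them to generic points of components (`GeneralizingMap.image_mem_genericPoints`); a
  continuous closed generalizing map sends irreducible components onto irreducible components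
  (`image_mem_irreducibleComponents_of_isClosedMap_of_generalizingMap`); in a Noetherian space a
  dense open contains all generic points of components, and a set containing them is dense
  (`genericPoints_subset_of_isOpen_of_dense`, `dense_of_genericPoints_subset`); a continuous
  closed map with incomparable fibres preserves the dimension of closed subsets
  (`topologicalKrullDim_image_eq_of_isClosedMap`);
* schemes: for `π` flat and integral, `π(C')` is an irreducible component of `F` of the same
  dimension as `C'` for every irreducible component `C'` of `F'`
  (`image_mem_irreducibleComponents_of_flat_of_isIntegralHom`,
  `topologicalKrullDim_image_eq_of_isIntegralHom`); if `π` is moreover surjective every component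
  of `F` so arises (`exists_image_eq_of_mem_irreducibleComponents`), so "all irreducible
  components have dimension `d`" passes from `F` to `F'`
  (`topologicalKrullDim_of_mem_irreducibleComponents_eq_of_flat_of_isIntegralHom`); and for `π`
  flat with `F` Noetherian, preimages of dense opens are dense (`dense_preimage_of_flat`).

## Sources

* The Stacks Project, Tag 0ECG (integral morphisms and dimension), Tag 03HV (generizations
  lift along flat morphisms), Tag 00GT (incomparability), Tag 004W (irreducible components).
-/

noncomputable section

open CategoryTheory CategoryTheory.Limits AlgebraicGeometry TopologicalSpace Topology

namespace Literature.AlgebraicGeometry.Resolution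

universe u

/-! ## Topology: generic points of components, closed generalizing maps, dimension -/

section Topology

variable {X Y : Type*} [TopologicalSpace X] [TopologicalSpace Y]

/-- In a sober `T₀` space, `y` is the generic point of an irreducible component iff `y` is
maximal for specialisation: every `y' ⤳ y` equals `y`. [folklore] -/
theorem mem_genericPoints_iff_forall_specializes [QuasiSober Y] [T0Space Y] {y : Y} :
    y ∈ genericPoints Y ↔ ∀ y', y' ⤳ y → y' = y := by
  constructor
  · intro hy y' hy'
    -- `closure {y'}` is irreducible and contains the component `closure {y}`
    have hsub : closure ({y} : Set Y) ⊆ closure {y'} := by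
      rw [(isClosed_closure (s := ({y'} : Set Y))).closure_subset_iff, Set.singleton_subset_iff]
      exact specializes_iff_mem_closure.mp hy'
    have heq : closure ({y'} : Set Y) ⊆ closure {y} :=
      hy.2 isIrreducible_singleton.closure hsub
    have h1 : y ⤳ y' := specializes_iff_mem_closure.mpr (heq (subset_closure rfl))
    exact (h1.antisymm hy').eq.symm
  · intro h
    refine ⟨isIrreducible_singleton.closure, fun S hS hyS => ?_⟩
    -- `S` irreducible containing `closure {y}`: its generic point generalises `y`
    have hgen := hS.isGenericPoint_genericPoint_closure
    have hy' : hS.genericPoint ⤳ y := hgen.specializes (subset_closure (hyS (subset_closure rfl)))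
    have := h _ hy'
    rw [this] at hgen
    calc S ⊆ closure S := subset_closure
      _ = closure {y} := hgen.symm

/-- A generalizing map between sober `T₀` spaces sends generic points of irreducible components
to generic points of irreducible components. [folklore] -/
theorem GeneralizingMap.image_mem_genericPoints [QuasiSober X] [T0Space X] [QuasiSober Y]
    [T0Space Y] {f : Y → X} (hf : GeneralizingMap f) {y : Y} (hy : y ∈ genericPoints Y) :
    f y ∈ genericPoints X := by
  rw [mem_genericPoints_iff_forall_specializes] at hy ⊢
  intro x hx
  obtain ⟨y', hy', rfl⟩ := hf hx
  rw [hy y' hy']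

/-- A continuous closed map sends the closure of a point onto the closure of its image.
[folklore] -/
theorem image_closure_singleton_of_isClosedMap {f : Y → X} (hfc : Continuous f)
    (hcl : IsClosedMap f) (y : Y) : f '' closure {y} = closure {f y} := by
  rw [← hcl.closure_image_eq_of_continuous hfc, Set.image_singleton]

/-- **A continuous, closed, generalizing map sends irreducible components onto irreducible
components** (sober `T₀` spaces): a component is the closure of its generic point `y`, its
image is the closure of `f y`, and `f y` is again the generic point of a component.
[folklore] -/
theorem image_mem_irreducibleComponents_of_isClosedMap_of_generalizingMap [QuasiSober X]
    [T0Space X] [QuasiSober Y] [T0Space Y] {f : Y → X} (hfc : Continuous f) (hcl : IsClosedMap f)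
    (hf : GeneralizingMap f) {C : Set Y} (hC : C ∈ irreducibleComponents Y) :
    f '' C ∈ irreducibleComponents X := by
  -- the generic point of `C`
  have hgen := hC.1.isGenericPoint_genericPoint (isClosed_of_mem_irreducibleComponents C hC)
  have hy : hC.1.genericPoint ∈ genericPoints Y := by
    show closure {hC.1.genericPoint} ∈ irreducibleComponents Y
    rw [hgen.def]
    exact hC
  have hx := GeneralizingMap.image_mem_genericPoints hf hy
  have : f '' C = closure {f hC.1.genericPoint} := by
    rw [← image_closure_singleton_of_isClosedMap hfc hcl, hgen.def]
  rw [this]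
  exact hx

/-- In a sober `T₀` space, a set containing all generic points of irreducible components is
dense. [folklore] -/
theorem dense_of_genericPoints_subset [QuasiSober Y] [T0Space Y] {S : Set Y}
    (hS : genericPoints Y ⊆ S) : Dense S :=
  Dense.mono hS (dense_iff_closure_eq.mpr (genericPoints.closure (α := Y)))

/-- **In a Noetherian sober `T₀` space a dense open contains all generic points of irreducible
components**: the complement of the other (finitely many) components is a non-empty open inside
the component, which the dense open meets, and opens are stable under generization.
[folklore] -/
theorem genericPoints_subset_of_isOpen_of_dense [NoetherianSpace Y] [QuasiSober Y] [T0Space Y]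
    {D : Set Y} (hD : IsOpen D) (hDd : Dense D) : genericPoints Y ⊆ D := by
  intro y hy
  have hC : closure {y} ∈ irreducibleComponents Y := hy
  have hfin := NoetherianSpace.finite_irreducibleComponents (α := Y)
  -- the open `U = (⋃ other components)ᶜ` has closure the component `closure {y}`
  set U : Set Y := (⋃₀ (irreducibleComponents Y \ {closure {y}}))ᶜ with hU
  have hUo : IsOpen U := by
    rw [hU, Set.sUnion_eq_biUnion, isOpen_compl_iff]
    exact hfin.sdiff.isClosed_biUnion fun W hW => isClosed_of_mem_irreducibleComponents W hW.1
  have hUcl : closure U = closure {y} :=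
    closure_sUnion_irreducibleComponents_sdiff_singleton hfin _ hC
  have hUne : U.Nonempty := by
    by_contra h
    rw [Set.not_nonempty_iff_eq_empty] at h
    rw [h, closure_empty] at hUcl
    exact (Set.singleton_nonempty y).ne_empty (Set.subset_empty_iff.mp (hUcl ▸ subset_closure))
  -- `D` meets `U` at some `u`, a specialisation of `y`; `D ∩ U` is open, so contains `y`
  obtain ⟨u, huU, huD⟩ := hDd.inter_open_nonempty U hUo hUne
  have hyu : y ⤳ u := by
    rw [specializes_iff_mem_closure, ← hUcl]
    exact subset_closure huU
  exact hyu.mem_open hD huD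

/-- **A continuous closed map with incomparable fibres preserves the dimension of closed
subsets**: for `f : Y → X` continuous and closed between sober `T₀` spaces such that `a ⤳ b`,
`f a = f b` imply `a = b`, and `C ⊆ Y` closed, `dim C = dim f(C)` (subspace topologies):
`≤` by incomparability (`f` is strictly monotone on specialisation chains), `≥` by going down
chains along the closed, hence specializing, `f`. [cite: StacksProject, Tag 0ECG (Lemma 29.45.9)] -/
theorem topologicalKrullDim_image_eq_of_isClosedMap [QuasiSober X] [T0Space X] [QuasiSober Y]
    [T0Space Y] {f : Y → X} (hfc : Continuous f) (hcl : IsClosedMap f)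
    (hinc : ∀ ⦃a b : Y⦄, a ⤳ b → f a = f b → a = b) {C : Set Y} (hC : IsClosed C) :
    topologicalKrullDim C = topologicalKrullDim (f '' C) := by
  haveI := Literature.Topology.quasiSober_of_isClosed hC
  haveI := Literature.Topology.quasiSober_of_isClosed (hcl C hC)
  let g : C → f '' C := Set.imageFactorization f C
  have hgc : Continuous g := (hfc.comp continuous_subtype_val).subtype_mk _
  apply le_antisymm
  · -- incomparability
    refine Literature.AlgebraicGeometry.Motives.topologicalKrullDim_le_of_specializes_imp_eq hgc
      fun a b hab hgab => Subtype.ext (hinc ?_ ?_)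
    · exact (subtype_specializes_iff a b).mp hab
    · exact congrArg Subtype.val hgab
  · -- going down specialisations along the closed map `f`
    refine Literature.AlgebraicGeometry.Motives.topologicalKrullDim_le_of_specializingMap_of_surjective
      (f := g) (fun a b hab => ?_) Set.imageFactorization_surjective
    -- `hab : g a ⤳ b`; lift along the specializing `f`
    have h1 : f a.1 ⤳ b.1 := (subtype_specializes_iff (g a) b).mp hab
    obtain ⟨a', haa', hfa'⟩ := hcl.specializingMap h1
    have ha'C : a' ∈ C := haa'.mem_closed hC a.2
    refine ⟨⟨a', ha'C⟩, (subtype_specializes_iff a ⟨a', ha'C⟩).mpr haa', Subtype.ext ?_⟩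
    exact hfa'

end Topology

/-! ## Schemes: flat integral morphisms -/

section Schemes

variable {F' F : Scheme.{u}} (π : F' ⟶ F)

/-- **Flat integral morphisms send irreducible components onto irreducible components**: flat
morphisms are generalizing (Stacks 03HV) and integral morphisms are closed.
[cite: StacksProject, Tag 03HV (Lemma 29.25.9)] -/
theorem image_mem_irreducibleComponents_of_flat_of_isIntegralHom [Flat π] [IsIntegralHom π]
    {C' : Set F'} (hC' : C' ∈ irreducibleComponents F') : π '' C' ∈ irreducibleComponents F :=
  image_mem_irreducibleComponents_of_isClosedMap_of_generalizingMap π.continuous π.isClosedMap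
    (Flat.generalizingMap π) hC'

/-- **Integral morphisms preserve the dimension of closed subsets** (Stacks 0ECG; Görtz–Wedhorn I,
Prop. 12.12: "let `Z ⊆ X` be a closed set. Then `f(Z)` is closed in `Y` and one has
`dim Z = dim f(Z)`"): integral morphisms are closed with incomparable fibres
(`eq_of_specializes_of_isIntegralHom`). [cite: StacksProject, Tag 0ECG (Lemma 29.45.9)] -/
theorem topologicalKrullDim_image_eq_of_isIntegralHom [IsIntegralHom π] {C' : Set F'}
    (hC' : IsClosed C') : topologicalKrullDim C' = topologicalKrullDim (π '' C') :=
  topologicalKrullDim_image_eq_of_isClosedMap π.continuous π.isClosedMap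
    (fun _ _ hab hpab => eq_of_specializes_of_isIntegralHom π hab hpab) hC'

/-- For a flat, integral and surjective morphism, every irreducible component of the target is
the image of an irreducible component of the source (lift the generic point and generalize it
to a generic point of a component). [folklore] -/
theorem exists_image_eq_of_mem_irreducibleComponents [Flat π] [IsIntegralHom π] [Surjective π]
    {C : Set F} (hC : C ∈ irreducibleComponents F) :
    ∃ C' ∈ irreducibleComponents F', π '' C' = C := by
  have hgen := hC.1.isGenericPoint_genericPoint (isClosed_of_mem_irreducibleComponents C hC)
  set c := hC.1.genericPoint with hc
  have hcmax : c ∈ genericPoints F := by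
    show closure {c} ∈ irreducibleComponents F
    rw [hgen.def]
    exact hC
  obtain ⟨x₀, hx₀⟩ := π.surjective c
  -- a generic point `x` of a component of `F'` generalizing `x₀`
  let C₀ := irreducibleComponent x₀
  have hC₀ : C₀ ∈ irreducibleComponents F' := irreducibleComponent_mem_irreducibleComponents x₀
  have hgen₀ := hC₀.1.isGenericPoint_genericPoint (isClosed_of_mem_irreducibleComponents C₀ hC₀)
  set x := hC₀.1.genericPoint with hx
  have hxx₀ : x ⤳ x₀ := hgen₀.specializes mem_irreducibleComponent
  -- `π x` generalizes `c`, hence equals it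
  have hπx : π x = c := by
    have h1 : π x ⤳ c := hx₀ ▸ hxx₀.map π.continuous
    exact (mem_genericPoints_iff_forall_specializes.mp hcmax) _ h1
  refine ⟨C₀, hC₀, ?_⟩
  rw [← hgen₀.def, image_closure_singleton_of_isClosedMap π.continuous π.isClosedMap, hπx]
  exact hgen.def

/-- **Equidimensionality of components passes along flat integral surjections**: if every
irreducible component of `F` has dimension `d`, so has every irreducible component of `F'`.
[cite: StacksProject, Tag 0ECG (Lemma 29.45.9)] -/
theorem topologicalKrullDim_of_mem_irreducibleComponents_eq_of_flat_of_isIntegralHom [Flat π]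
    [IsIntegralHom π] {d : WithBot ℕ∞}
    (hF : ∀ C ∈ irreducibleComponents F, topologicalKrullDim C = d) :
    ∀ C' ∈ irreducibleComponents F', topologicalKrullDim C' = d := fun C' hC' => by
  rw [topologicalKrullDim_image_eq_of_isIntegralHom π (isClosed_of_mem_irreducibleComponents C' hC')]
  exact hF _ (image_mem_irreducibleComponents_of_flat_of_isIntegralHom π hC')

/-- **Preimages of dense opens under flat morphisms to Noetherian schemes are dense**: the dense
open contains the generic points of the components of `F`, so its preimage contains those of
`F'` (flat morphisms are generalizing), hence is dense. [cite: StacksProject, Tag 03HV (Lemma 29.25.9)] -/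
theorem dense_preimage_of_flat [Flat π] [NoetherianSpace F] {D : Set F} (hD : IsOpen D)
    (hDd : Dense D) : Dense (π ⁻¹' D) := by
  refine dense_of_genericPoints_subset fun x hx => ?_
  exact genericPoints_subset_of_isOpen_of_dense hD hDd
    (GeneralizingMap.image_mem_genericPoints (Flat.generalizingMap π) hx)

end Schemes

/-! ## Base change of a scheme over a field to an algebraic extension -/

section FieldExtension

variable (κ κ' : Type u) [Field κ] [Field κ'] [Algebra κ κ']

/-- `Spec κ' → Spec κ` is flat (everything is flat over a field). [folklore] -/
theorem flat_SpecMap_algebraMap_of_field :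
    Flat (Spec.map (CommRingCat.ofHom (algebraMap κ κ'))) := by
  rw [HasRingHomProperty.Spec_iff (P := @Flat), CommRingCat.hom_ofHom]
  exact RingHom.Flat.of_isField (Field.toIsField κ) _

-- `Spec κ' → Spec κ` is surjective (`Spec κ` is a point): this is Mathlib's instance
-- `instSurjectiveOfNonemptyOfSubsingletonCarrierCarrierCommRingCat`, found by `inferInstance`.

/-- `Spec κ' → Spec κ` is integral for `κ'/κ` algebraic. [folklore] -/
theorem isIntegralHom_SpecMap_algebraMap_of_isAlgebraic [Algebra.IsAlgebraic κ κ'] :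
    IsIntegralHom (Spec.map (CommRingCat.ofHom (algebraMap κ κ'))) := by
  refine IsIntegralHom.SpecMap_iff.mpr ?_
  change (algebraMap κ κ').IsIntegral
  exact fun x => Algebra.IsIntegral.isIntegral x

variable {κ κ'} {F : Scheme.{u}} (q : F ⟶ Spec (.of κ))

/-- **Irreducible components of the base change `F ⊗_κ κ'` of a `κ`-scheme to an algebraic
extension `κ'` have the dimensions of the components of `F`**: if every irreducible component of
`F` has dimension `d`, so has every irreducible component of `F ×_{Spec κ} Spec κ'` — the
projection is flat, integral and surjective. [cite: StacksProject, Tag 0ECG (Lemma 29.45.9)] -/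
theorem topologicalKrullDim_of_mem_irreducibleComponents_pullback_of_isAlgebraic
    [Algebra.IsAlgebraic κ κ'] {d : WithBot ℕ∞}
    (hF : ∀ C ∈ irreducibleComponents F, topologicalKrullDim C = d) :
    ∀ C' ∈ irreducibleComponents
        ↥(pullback q (Spec.map (CommRingCat.ofHom (algebraMap κ κ')))),
      topologicalKrullDim C' = d := by
  haveI := flat_SpecMap_algebraMap_of_field κ κ'
  haveI := isIntegralHom_SpecMap_algebraMap_of_isAlgebraic κ κ'
  exact topologicalKrullDim_of_mem_irreducibleComponents_eq_of_flat_of_isIntegralHom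
    (pullback.fst q (Spec.map (CommRingCat.ofHom (algebraMap κ κ')))) hF

/-- The projection `F ⊗_κ κ' → F` has dense preimages of dense opens, for `F` Noetherian (e.g.
of finite type over `κ`). [folklore] -/
theorem dense_preimage_pullback_fst_of_field [NoetherianSpace F] {D : Set F} (hD : IsOpen D)
    (hDd : Dense D) :
    Dense (pullback.fst q (Spec.map (CommRingCat.ofHom (algebraMap κ κ'))) ⁻¹' D) := by
  haveI := flat_SpecMap_algebraMap_of_field κ κ'
  exact dense_preimage_of_flat _ hD hDd

end FieldExtension

end Literature.AlgebraicGeometry.Resolution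

end
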